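import Summits.HodgeConjecture.CorCM.Census.MultiFieldWeilDefect
import HarnessLib

/-!
# MULTI-FIELD WEIL, census part 3: the DEFECT LAW from JOINT TRANSITIVITY — any number of CM fields with ONE-MEMBER types (one embedding over `τ`
# each), realised tuples jointly transitive on the product of the `τ`-fibres

COR-CM (cell `pub-hodgecm2`), seat b30 gen 28 (2026-08-23); count-neutral own lane MULTI-FIELD WEIL ENGINE, sequel of `Census/MultiFieldWeilDefect.lean`.
Theorems of the finite model plus one bookkeeping definition (`JointTransitiveG`); no named fact, no geometry, no `sorry`, no `decide`.

THE ARGUMENT (the `r`-field form of gen 26ʼs `SexticOcticWeil.defectS_of_signed_jointTransitive`).  Every type is read at ONE position `p m`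
(`P m = {p m}`, `k`-signature `(1, n_m − 1)`, curve multiplicity `c_m = n_m − 2`).  If the realised tuples move EVERY tuple of pairs
`x = (x_m)_m` to the base tuple `(p_m)_m` (`JointTransitiveG` — downstream automatic e.g. for pairwise coprime relative degrees), the signed
equation at such a tuple reads `e + Σ_m (2 d_m(x_m) − Σ_a d_m(a)) = 0`; comparing two tuples that differ in one coordinate gives `d_m ≡ t_m`, and
then `e = Σ_m (n_m − 2) t_m`: **`defectG_of_signed_jointTransitive`**, on configurations **`exists_hasDefectsG_of_jointTransitiveG`** — the
hypothesis `hdef` of the generic headline `MultiFieldWeil.hodgeConjectureFor_biproduct_comp_of_defectLawG` for every such instance.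
[cite: MoonenZarhin1995Duke, Thm. 2.4] [cite: GaoUllmo2025, Thm 3.1] [cite: DixonMortimer1996, §2.1]

## References
* [MoonenZarhin1995Duke] B. Moonen, Yu. Zarhin, Duke Math. J. 77 (1995), Thm. 2.4.  [GaoUllmo2025] Z. Gao, E. Ullmo, J. Inst. Math. Jussieu
  25 (2025), Thm 3.1.  [DixonMortimer1996] J. D. Dixon, B. Mortimer, *Permutation Groups*, GTM 163, §2.1.
-/

namespace Summit.HodgeConjecture.CorCM.Census.MultiFieldWeil

open Finset

variable {r : ℕ} {n : Fin r → ℕ}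

/-- **Joint transitivity on the base tuple `p`**: every tuple of pairs is moved to `p` by a member of `R`. [cite: DixonMortimer1996, §2.1] -/
def JointTransitiveG (R : Finset (PermsG n)) (p : ∀ m : Fin r, Fin (n m)) : Prop :=
  ∀ x : ∀ m : Fin r, Fin (n m), ∃ π ∈ R, ∀ m, π m (x m) = p m

/-- The signed sum through a ONE-MEMBER position set: `Σ_a (σ a ∈ {q} ? f a : −f a) = 2 f (σ⁻¹ q) − Σ f`. [folklore] -/
theorem sum_ite_mem_singleton_eq {k : ℕ} (σ : Equiv.Perm (Fin k)) (q : Fin k) {x : Fin k} (hx : σ x = q) (f : Fin k → ℤ) :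
    (∑ a : Fin k, (if σ a ∈ ({q} : Finset (Fin k)) then f a else -f a)) = 2 * f x - ∑ a : Fin k, f a := by
  rw [sum_ite_mem_eq]
  have hfilter : (univ.filter fun a => σ a ∈ ({q} : Finset (Fin k))) = {x} := by
    ext a
    rw [Finset.mem_filter, Finset.mem_singleton, Finset.mem_singleton]
    constructor
    · rintro ⟨-, ha⟩
      exact σ.injective (ha.trans hx.symm)
    · rintro rfl
      exact ⟨Finset.mem_univ _, hx⟩
  rw [hfilter, Finset.sum_singleton]

section Defect

variable {R : Finset (PermsG n)} {P : ∀ m : Fin r, Finset (Fin (n m))} {p : ∀ m : Fin r, Fin (n m)}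

/-- **THE DEFECT LAW FROM JOINT TRANSITIVITY (integer form).**  One-member position sets `P m = {p m}`, `R` jointly transitive on `p`: if `e`, `d`
satisfy the signed equation at every tuple of `R`, then `d_m ≡ t_m` and `e = Σ_m (n_m − 2) t_m`. [cite: MoonenZarhin1995Duke, Thm. 2.4]
[cite: GaoUllmo2025, Thm 3.1] -/
theorem defectG_of_signed_jointTransitive (hP : ∀ m, P m = {p m}) (hjt : JointTransitiveG R p)
    {e : ℤ} {d : ∀ m : Fin r, Fin (n m) → ℤ}
    (h : ∀ π ∈ R, e + ∑ m : Fin r, ∑ a : Fin (n m), (if π m a ∈ P m then d m a else -d m a) = 0) :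
    ∃ t : Fin r → ℤ, (∀ (m : Fin r) (a : Fin (n m)), d m a = t m) ∧ e = ∑ m : Fin r, ((n m : ℤ) - 2) * t m := by
  classical
  -- the equation at a tuple moving `x` to `p`
  have heq : ∀ x : ∀ m : Fin r, Fin (n m), e + ∑ m : Fin r, (2 * d m (x m) - ∑ a : Fin (n m), d m a) = 0 := by
    intro x
    obtain ⟨π, hπ, hx⟩ := hjt x
    have h1 := h π hπ
    have hsum : ∀ m : Fin r, (∑ a : Fin (n m), (if π m a ∈ P m then d m a else -d m a)) = 2 * d m (x m) - ∑ a : Fin (n m), d m a := by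
      intro m
      rw [hP m]
      exact sum_ite_mem_singleton_eq (π m) (p m) (hx m) (d m)
    rw [Finset.sum_congr rfl fun m _ => hsum m] at h1
    exact h1
  -- `d_m` is constant: compare `p` with `p` changed at `m₀`
  have hconst : ∀ (m₀ : Fin r) (a : Fin (n m₀)), d m₀ a = d m₀ (p m₀) := by
    intro m₀ a
    have h1 := heq (Function.update p m₀ a)
    have h2 := heq p
    have hsplit : ∀ x : ∀ m : Fin r, Fin (n m), (∑ m : Fin r, (2 * d m (x m) - ∑ a : Fin (n m), d m a)) =
        (2 * d m₀ (x m₀) - ∑ a : Fin (n m₀), d m₀ a) +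
          ∑ m ∈ univ.erase m₀, (2 * d m (x m) - ∑ a : Fin (n m), d m a) := fun x =>
      (Finset.add_sum_erase univ (fun m => 2 * d m (x m) - ∑ a : Fin (n m), d m a) (Finset.mem_univ m₀)).symm
    have hrest : (∑ m ∈ univ.erase m₀, (2 * d m (Function.update p m₀ a m) - ∑ a : Fin (n m), d m a)) =
        ∑ m ∈ univ.erase m₀, (2 * d m (p m) - ∑ a : Fin (n m), d m a) :=
      Finset.sum_congr rfl fun m hm => by rw [Function.update_of_ne (Finset.ne_of_mem_erase hm)]
    rw [hsplit, hrest, Function.update_self] at h1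
    rw [hsplit] at h2
    linarith
  refine ⟨fun m => d m (p m), fun m a => hconst m a, ?_⟩
  have h0 := heq p
  have hD : ∀ m : Fin r, (∑ a : Fin (n m), d m a) = (n m : ℤ) * d m (p m) := fun m => by
    rw [Finset.sum_congr rfl fun a _ => hconst m a, Finset.sum_const, Finset.card_univ, Fintype.card_fin, nsmul_eq_mul]
  rw [Finset.sum_congr rfl fun m _ => by rw [hD m]] at h0
  have : e = -∑ m : Fin r, (2 * d m (p m) - (n m : ℤ) * d m (p m)) := by linarith
  rw [this, ← Finset.sum_neg_distrib]
  exact Finset.sum_congr rfl fun m _ => by ring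

end Defect

/-! ### The defect law for configurations -/

section Config

variable {α : Type*} {R : Finset (PermsG n)} {P : ∀ m : Fin r, Finset (Fin (n m))} {p : ∀ m : Fin r, Fin (n m)} {v : α → PtG n}

/-- **THE DEFECT LAW FOR CONFIGURATIONS, any number of one-member types under joint transitivity**: an `R`-balanced configuration obeys the defect law
with curve multiplicities `c_m = n_m − 2` (`2 ≤ n_m`) — the hypothesis `hdef` of `MultiFieldWeil.hodgeConjectureFor_biproduct_comp_of_defectLawG`.
[cite: MoonenZarhin1995Duke, Thm. 2.4] [cite: GaoUllmo2025, Thm 3.1] -/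
theorem exists_hasDefectsG_of_jointTransitiveG (hP : ∀ m, P m = {p m}) (hjt : JointTransitiveG R p) (hn : ∀ m, 2 ≤ n m)
    {T : Finset α} (hT : ModelBalancedG P R v T) : ∃ t : Fin r → ℤ, HasDefectsG (fun m => n m - 2) v T t := by
  obtain ⟨t, hd, he⟩ := defectG_of_signed_jointTransitive hP hjt (e := (cnt v T (Sum.inl true) : ℤ) - cnt v T (Sum.inl false))
    (d := fun m a => (cnt v T (Sum.inr ⟨m, (a, true)⟩) : ℤ) - cnt v T (Sum.inr ⟨m, (a, false)⟩))
    fun π hπ => signed_of_modelBalancedG R v hT hπ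
  refine ⟨t, fun m a => hd m a, ?_⟩
  rw [he]
  exact Finset.sum_congr rfl fun m _ => by rw [Nat.cast_sub (hn m)]; norm_num

/-- **Balanced under a jointly transitive `R` ⟹ balanced under every set of tuples.** [folklore] -/
theorem ModelBalancedG.of_jointTransitiveG (hP : ∀ m, P m = {p m}) (hjt : JointTransitiveG R p) (hn : ∀ m, 2 ≤ n m)
    {T : Finset α} (hT : ModelBalancedG P R v T) (R' : Finset (PermsG n)) : ModelBalancedG P R' v T := by
  obtain ⟨t, ht⟩ := exists_hasDefectsG_of_jointTransitiveG hP hjt hn hT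
  refine modelBalancedG_of_hasDefects (fun m => ?_) ht R'
  rw [hP m, Finset.card_singleton, Nat.cast_sub (hn m)]
  push_cast
  ring

end Config

end Summit.HodgeConjecture.CorCM.Census.MultiFieldWeil
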